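import Summits.AtomisticToContinuum.HydrodynamicLimit.Theorems.InformationPercolationEngineKickFairRelEquilibriumTransfer
import HarnessLib

/-!
# Line `Sketch` (card `affine-fibre-statics`, COMPOSED form) for the crux `KickFairRelEquilibrium`
# (stmt-AtomisticToContinuum-14914, route `InformationPercolationEngine`, rank 2)

The crux: under the LOCAL Gibbs law `LG_N = localGibbsLaw σ a₀ u₀ θ₀ N (Φ N)` the normalised,
past-weighted, EQUILIBRIUM-CENTRED kick sum
`S_h = (ε/(N+1)) Σ_i Σ_{n < cnt_i} h_{i,n}(P_{i,n}) (g(X_{i,n}) − κ_{i,n})`,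
`κ_{i,n} = E_G[g(X_{i,n}) | σ(P_{i,n})]` (Mathlib `condExp` under the invariant law
`G = localGibbsLaw σ 1 0 1 N (Φ N)`), has `E_{LG}|S_h| ≤ δ` for `N ≥ N₀`, uniformly over measurable
weights `|h| ≤ 1` of the typed coarse past.

## The line, composed (card `Ideas/affine-fibre-statics.md` §Transfer; crux informal text:
## "euler-time-beats-entropy (super-exponential transfer G → LG) + [equilibrium mechanism] — two
## stages of one line")

* STAGE 1 — TRANSFER `G → LG`, KL-free density route, PROVED (landed p96578 as
  `Theorems/InformationPercolationEngineKickFairRelEquilibriumTransfer.lean`) from the tree: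
  `exists_localGibbsMeasure_le_smul_const` (`localGibbsMeasure σ a₀ u₀ θ₀ N ≤ Λ^{N+1} • G_{θ₁}`,
  `θ₁ = 2 sup θ₀`, all `σ ≤ 1/2`, all `N`), `localGibbsLaw_eq` (the law is the flow-free measure),
  `isProbabilityMeasure_localGibbsLaw`; plus the pointwise split `|S| ≤ δ/2 + (|S| − δ/2)₊` and
  monotonicity of the LOWER Lebesgue integral in the measure (`lintegral_mono'`,
  `lintegral_smul_measure`) — no measurability of `S` is needed anywhere (the decl integrates `∫⁻`).
  Result: `E_{LG}|S_h| ≤ δ/2 + Λ^{N+1} · ∫⁻ (|S_h| − δ/2)₊ dG_{θ₁}`.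
* STAGE 2 — THE EQUILIBRIUM INPUT, the single registered stub `stub_eqKickTail`
  (`EqKickSuperexp(centred)`, L¹-tail form): under the HOMOGENEOUS invariant law at every temperature
  `θ₁ > 0` the δ-excess of the centred kick sum is super-exponentially small in L¹, at EVERY rate `K`,
  uniformly over admissible weights: `∫⁻ (|S_h| − δ)₊ dG_{θ₁} ≤ e^{−K(N+1)}` for `N ≥ N₀(…, δ, K)`.
  The centring `κ` stays the decl's (under `G_1`): `dG_{θ₁}/dG_1 ∝ exp((1/2 − 1/(2θ₁)) Σ|v_i|²)` is a
  function of the conserved kinetic energy, which the typed past (all exact velocities at a flight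
  start) determines, so `E_{G_{θ₁}}[· | σ(P)] = E_{G_1}[· | σ(P)]` and `κ` is the right centring
  under every `G_{θ₁}` (the decl's "G's nominal parameters are immaterial").
  This stub is where ALL the dynamics lives (equilibrium half (a) of the crux in large-deviation
  strength); the card's statics lemmas L1–L3 (`AffineFibreStaticsSketch.lean`: flux law from a
  uniform impact parameter, impact line of a resolved kick, shields as cap cuts) IDENTIFY `κ` — the
  engine's need (`PercolationClosesChaos` step (v)) — but do not enter `KickFairRelEquilibrium_of`:
  the crux is relative to `κ` whatever `κ` is (memo `Analysis-r1-k1.md` §F1).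
* COMPOSITION `KickFairRelEquilibrium_of : stub_eqKickTail → KickFairRelEquilibrium`:
  `σ₀ := min σ₁(θ₁) (1/2)`, stub at `δ/2` and `K := log Λ + 1`, so
  `E_{LG}|S_h| ≤ δ/2 + Λ^{N+1} e^{−K(N+1)} = δ/2 + e^{−(N+1)} ≤ δ` for `N ≥ max N₀ N₁`.

## Landed for this line (all `--supports stmt-AtomisticToContinuum-14914`, sorry-free, axioms whitelist)

* p96578 `Theorems/InformationPercolationEngineKickFairRelEquilibriumTransfer.lean` — Stage 1:
  `KickFairRelEquilibrium_of_eqKickTail` (the composition below is one application of it).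
* p98668 `Theorems/InformationPercolationEngineKickFairRelEquilibriumFluxDisc.lean` — the card's L1
  `integral_flux_eq_integral_disc` (flux law on `S²` = uniform impact parameter on the disc,
  `∫_{S²} G(ω)(−ω₃)₊ dσ = ∫_{|b|<1} G(b, −√(1−|b|²)) db`, CIP 1994 App. 4.A; also in `∫⁻` form
  `KickFairRelEquilibriumFluxDisc.lintegral_flux_eq_lintegral_disc`): the kernel-identification side
  (route child `EqKickKernel`), now with NO sorry left in the card's `AffineFibreStaticsSketch.lean`
  content (L2, L3 were proved there).
* p99854 `Theorems/InformationPercolationEngineKickFairRelEquilibriumCondExpDensity.lean` —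
  `condExp_withDensity_ae_eq_of_measurable`: `condExp` given `m` is invariant under an
  `m`-measurable change of density; with `dG_{θ₁}/dG_1` a function of the conserved (past-measurable)
  kinetic energy this is why the decl's `κ` (under `G_1`) is the right centring in the stub (under
  `G_{θ₁}`).

## Standing of the stub (honest)

`Analysis-r1-k1.md` §F4 argues that AT FIXED CELL SIZE `r` the stub is FALSE (sub-cell hydrodynamic
modes invisible to the typed past cost only `e^{−cNa²}` under `G` and bias the centred kicks by
`≍ φa²`: a speed-`N` large-deviation LOWER bound `G(|S_1| > δ) ≳ e^{−CNδ/φ}`, never super-exponential),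
and §F3 that the decl itself is then false for small `δ` (relative defect `≍ φ r² |∇ log f|²`); both
are consistent exactly in the window `ε ≪ r_N ≪ N^{-1/6}` (repair R2). This skeleton is insensitive to
that choice: replacing `Torus.coarseCell r` by `Torus.coarseCell (r_N)` in the decl changes the stub's
let-chain verbatim and nothing else. No `Disproof.lean` exists for 14914 at the time of writing
(`ledger crux ls`): nothing to honour beyond the 13478 negative lemma (shielding), which is inside `κ`.
-/

noncomputable section

open MeasureTheory Set Filter Topology
open scoped ENNReal Classical

namespace Summit.AtomisticToContinuum.HydrodynamicLimit.Cruxes.KickFairRelEquilibrium.Sketch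

open Literature.Analysis.FluidPDE Literature.MathematicalPhysics.KineticTheory

/-! ## Stage 1: the transfer — LANDED in the tree (p96578,
`Theorems/InformationPercolationEngineKickFairRelEquilibriumTransfer.lean`:
`KickFairRelEquilibriumTransfer.lintegral_ofReal_abs_le_of_le_smul`,
`KickFairRelEquilibriumTransfer.pow_mul_exp_neg_log_add_one`,
`KickFairRelEquilibrium_of_eqKickTail` = registered sub-goal, sorry-free) -/

/-! ## Registered stubs (`Holds.stub_*`, bodies `sorry`) -/

namespace Holds

/-- **STUB `stub_eqKickTail` — `EqKickSuperexp(centred)`, L¹-tail form (the equilibrium input; OPEN,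
the whole dynamical content of the line).** For every temperature `θ₁ > 0` there is `σ₁ > 0` such
that for all `0 < σ < σ₁`, every flow family, horizon `τ > 0`, cell size `r > 0`, bounded continuous
`g`, every `δ > 0` and EVERY rate `K`, eventually in `N`, uniformly over measurable weights `|h| ≤ 1`
of the typed past: `∫⁻ (|S_h| − δ)₊ d(localGibbsLaw σ 1 0 θ₁ N (Φ N)) ≤ e^{−K(N+1)}`, where `S_h` is
the decl's centred kick sum VERBATIM (same let-chain; `κ` under `localGibbsLaw σ 1 0 1`, which is the
right centring under every `G_{θ₁}` because `dG_{θ₁}/dG_1` is a function of the conserved kinetic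
energy, a `σ(P)`-measurable quantity). Informal content: under the invariant law the compensated kick
sum — each kick centred at its own equilibrium conditional mean given the coarse past — concentrates
super-exponentially (speed faster than `N`), against adversarial past-measurable signs. Why plausible:
`≍ N^{4/3}` centred terms of size `σ N^{-4/3}` each; kinetic-scale structure biasing them over `[0, τ]`
costs `e^{−cN^{4/3}τ}`. Why it might fail AT FIXED `r` (memo `Analysis-r1-k1.md` §F4): sub-cell
hydrodynamic modes are invisible to the past, cost only `e^{−cNa²}`, and bias shielded kicks by
`≍ φa²` — a speed-`N` lower bound; the stub is then expected to hold only for cells `r_N → 0` with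
`ε ≪ r_N ≪ N^{-1/6}`. -/
theorem stub_eqKickTail :
    ∀ θ₁ : ℝ, 0 < θ₁ → ∃ σ₁ : ℝ, 0 < σ₁ ∧ ∀ σ : ℝ, 0 < σ → σ < σ₁ →
    ∀ Φ : (N : ℕ) → HardSphereFlow (Torus.geometry (Fin 3)) (hsDiameter σ N) (N + 1),
    ∀ τ : ℝ, 0 < τ → ∀ r : ℝ, 0 < r →
    ∀ g : V3 × V3 × V3 → ℝ, Continuous g → (∃ C : ℝ, ∀ p, |g p| ≤ C) →
    ∀ δ : ℝ, 0 < δ → ∀ K : ℝ, ∃ N₀ : ℕ, ∀ N : ℕ, N₀ ≤ N →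
    ∀ h : Fin (N + 1) → ℕ →
      (((Fin (N + 1) → (Fin 3 → ℤ) × V3) × (Fin (N + 1) → (Fin 3 → ℤ) × V3)) × Fin (N + 1)) ×
        (ℝ × ℝ × ℝ) → ℝ,
    (∀ i n, Measurable (h i n)) → (∀ i n p, |h i n p| ≤ 1) →
    let ε := hsDiameter σ N
    let G : Geometry (Fin 3) T3 := Torus.geometry (Fin 3)
    let q : T3 → (Fin 3 → ℤ) := Torus.coarseCell r
    let γ : Config (N + 1) (Fin 3) T3 → ℝ → Config (N + 1) (Fin 3) T3 := fun z s => (Φ N).flow s z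
    let cnt : Config (N + 1) (Fin 3) T3 → Fin (N + 1) → ℕ := fun z i =>
      Set.ncard (collisionTimesOf G ε (γ z) i ∩ Set.Ioc 0 τ)
    let P : Config (N + 1) (Fin 3) T3 → Fin (N + 1) → ℕ →
        (((Fin (N + 1) → (Fin 3 → ℤ) × V3) × (Fin (N + 1) → (Fin 3 → ℤ) × V3)) × Fin (N + 1)) ×
          (ℝ × ℝ × ℝ) := fun z i n =>
      if z ∈ (Φ N).good then
        (((Φ N).coarsePastOf q i n z, (Φ N).nthPartnerOf i n z),
          (flightStart G ε (γ z) 0 i ((Φ N).nthCollisionTimeOf i n z),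
            flightStart G ε (γ z) 0 ((Φ N).nthPartnerOf i n z) ((Φ N).nthCollisionTimeOf i n z),
            (Φ N).nthCollisionTimeOf i n z))
      else (((fun _ => (0, 0), fun _ => (0, 0)), 0), (0, 0, 0))
    let X : Fin (N + 1) → ℕ → Config (N + 1) (Fin 3) T3 → V3 × V3 × V3 := fun i n z =>
      if z ∈ (Φ N).good then (((Φ N).nthRecordOf i n z).impactVec, ((Φ N).nthRecordOf i n z).preVel)
      else 0
    let κ : Fin (N + 1) → ℕ → Config (N + 1) (Fin 3) T3 → ℝ := fun i n =>
      MeasureTheory.condExp (MeasurableSpace.comap (fun z => P z i n) inferInstance)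
        (localGibbsLaw σ (fun _ => 1) (fun _ => 0) (fun _ => 1) N (Φ N)) (fun z => g (X i n z))
    let S : Config (N + 1) (Fin 3) T3 → ℝ := fun z =>
      ε / (N + 1 : ℝ) * ∑ i : Fin (N + 1), ∑ n ∈ Finset.range (cnt z i),
        h i n (P z i n) * (g (X i n z) - κ i n z)
    ∫⁻ z, ENNReal.ofReal (|S z| - δ)
        ∂(localGibbsLaw σ (fun _ => 1) (fun _ => 0) (fun _ => θ₁) N (Φ N)) ≤
      ENNReal.ofReal (Real.exp (-(K * ((N : ℝ) + 1)))) := by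
  sorry

end Holds

/-! ## Stub statements by name (D-0027 §3.3: the hypotheses of `_of` are these `Prop`s) -/

/-- Statement of the registered stub `Holds.stub_eqKickTail`, by name. -/
def stub_eqKickTail : Prop := type_of% Holds.stub_eqKickTail

/-! ## Composition (sorry-free): the stub ⟹ the crux BY NAME -/

/-- **The skeleton theorem.** The crux from the single registered stub, through the LANDED transfer
`KickFairRelEquilibrium_of_eqKickTail` (p96578): `σ₀ := min (σ₁ θ₁) (1/2)` with `θ₁, Λ` from the
domination `localGibbsMeasure σ a₀ u₀ θ₀ N ≤ Λ^{N+1} • localGibbsMeasure σ 1 0 θ₁ N`, the stub at `δ/2`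
and rate `K = log Λ + 1`, so `E_{LG}|S_h| ≤ δ/2 + Λ^{N+1} e^{−K(N+1)} = δ/2 + e^{−(N+1)} ≤ δ`. The stub's
statement is the transfer theorem's hypothesis verbatim. -/
theorem KickFairRelEquilibrium_of (h1 : stub_eqKickTail) :
    Summit.AtomisticToContinuum.HydrodynamicLimit.Theses.InformationPercolationEngine.KickFairRelEquilibrium :=
  Summit.AtomisticToContinuum.HydrodynamicLimit.Theorems.KickFairRelEquilibrium_of_eqKickTail
    (h1 : type_of% Holds.stub_eqKickTail)

/-- D-0027 §3.3 shape: the crux from the registered stub — an `example`, so that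
`KickFairRelEquilibrium_of` stays the unique theorem concluding the crux; it becomes the proof of the
item once the `sorry` of `Holds.stub_eqKickTail` is discharged. -/
example :
    Summit.AtomisticToContinuum.HydrodynamicLimit.Theses.InformationPercolationEngine.KickFairRelEquilibrium :=
  KickFairRelEquilibrium_of Holds.stub_eqKickTail

end Summit.AtomisticToContinuum.HydrodynamicLimit.Cruxes.KickFairRelEquilibrium.Sketch

end
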